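import Literature.Computability.AlgebraicComplexity.BigCwSquareFormatValue112
import HarnessLib

/-!
# The twelve matrix components of `CW_q^{⊗2}` in format currency (Coppersmith–Winograd 1990 §8; Le Gall 2012 §3) — proved

Topic `Literature/Computability/AlgebraicComplexity`.  Of the fifteen merged components `T^{[IJL]}`
(`I + J + L = 4`) of the coarse decomposition of `CW_q ⊗ CW_q` (`BigCwSquareComponents.lean`:
`cwSqComp K q I J L`, labels `cwLev2`), twelve are (restrictions of) rectangular matrix products
(Coppersmith–Winograd 1990 §8; Le Gall 2012 §3, the list of the fifteen forms):
`[004], [040], [400] ≥ ⟨1,1,1⟩`; `[013], [031] ≥ ⟨1,2q,1⟩` with rotations `[130], [310] ≥ ⟨2q,1,1⟩`,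
`[301], [103] ≥ ⟨1,1,2q⟩`; `[022] ≥ ⟨1,q²+2,1⟩` with rotations `[220] ≥ ⟨q²+2,1,1⟩`,
`[202] ≥ ⟨1,1,q²+2⟩` (the tree's `tensorRestrictsTo_cwSqComp004/013/031/022` and `cwSqComp_rotate`).
This file records them in the FORMAT currency `HasFormatValue t v A B C` of `LaserFormatValue.lean`
("`t` is worth `v` independent products of format `(A,B,C)`", formats of `matMulTensor K A B C`;
rotation `t ↦ t_C` maps `(A,B,C) ↦ (B,C,A)`, `HasFormatValue.rotate_modes`): each of the twelve is
worth ONE product of the displayed format.  Together with the three non-matrix components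
`[112], [121], [211]` (`BigCwSquareFormatValue112.lean`) these are the per-letter data that the
rectangular laser method in format currency (`laserMethod_hasFormatValue_of_counts`, or its
word-value form `laserMethod_hasFormatValue_of_blockValue` with `HasFormatValue.kroneckerPi`)
consumes in the level-2 rectangular analyses of `CW_q ⊗ CW_q` (Coppersmith 1997 §3; Huang–Pan 1998
§3; Le Gall 2012 §6, Thm. 6.1: `Q ∋ (2q)^{a₁₀₃+a₃₀₁}(q²+2)^{a₂₀₂}`, `R ∋ (2q)^{2a₀₁₃}(q²+2)^{a₀₂₂}`).
The last section packages the twelve as ONE statement over the finset `cwSqMatrix₂` of matrix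
patterns with explicit format tables `cwSqFmtA/B/C` (all `≥ 1` for `q ≥ 1`), the shape in which a laser design
quotes its block data.

References:
* [CoppersmithWinograd1990] D. Coppersmith, S. Winograd, J. Symb. Comput. 9 (1990), §8.
* [LeGall2012] F. Le Gall, Faster algorithms for rectangular matrix multiplication, FOCS 2012,
  arXiv:1204.1111, §3 and §6 (Thm. 6.1).
* [Coppersmith1997] D. Coppersmith, J. Complexity 13 (1997), §3.
* [HuangPan1998] X. Huang, V. Pan, J. Complexity 14 (1998), §3.
-/

open Finset Real
open scoped BigOperators

universe u

namespace Literature.Computability.AlgebraicComplexity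

open Literature.Barriers.MatrixMultiplication

/-! ## The twelve matrix components -/

section Matrix

variable (K : Type u) [Field K] (q : ℕ)

/-- `T^{[004]} ≥ ⟨1,1,1⟩`: one product of format `(1,1,1)`. [cite: CoppersmithWinograd1990, §8] -/
theorem hasFormatValue_cwSqComp004 : HasFormatValue (cwSqComp K q 0 0 4) 1 1 1 1 := by
  simpa using (hasFormatValue_matMulTensor K 1 1 1).of_restrictsTo (tensorRestrictsTo_cwSqComp004 K q)

/-- `T^{[040]} = T^{[004]}_C ≥ ⟨1,1,1⟩`. [cite: CoppersmithWinograd1990, §8] -/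
theorem hasFormatValue_cwSqComp040 : HasFormatValue (cwSqComp K q 0 4 0) 1 1 1 1 := by
  rw [cwSqComp_rotate K q 0 0 4]; exact (hasFormatValue_cwSqComp004 K q).rotate_modes

/-- `T^{[400]} = T^{[040]}_C ≥ ⟨1,1,1⟩`. [cite: CoppersmithWinograd1990, §8] -/
theorem hasFormatValue_cwSqComp400 : HasFormatValue (cwSqComp K q 4 0 0) 1 1 1 1 := by
  rw [cwSqComp_rotate K q 0 4 0]; exact (hasFormatValue_cwSqComp040 K q).rotate_modes

/-- **`T^{[013]} ≥ ⟨1,2q,1⟩`**: one product of format `(1,2q,1)` (`x_{00}·(∑ᵢ y_{0i} z_{q+1,i} +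
∑ᵢ y_{i0} z_{i,q+1})`, an inner product of length `2q`). [cite: CoppersmithWinograd1990, §8]
[cite: LeGall2012, §3] -/
theorem hasFormatValue_cwSqComp013 : HasFormatValue (cwSqComp K q 0 1 3) 1 1 (2 * q) 1 := by
  have h := (hasFormatValue_matMulTensor K 1 (q + q) 1).of_restrictsTo
    (tensorRestrictsTo_cwSqComp013 K q)
  simp only [Nat.cast_one, Nat.cast_add] at h
  rw [← two_mul] at h
  exact h

/-- `T^{[130]} = T^{[013]}_C ≥ ⟨2q,1,1⟩`: format `(2q,1,1)`. [cite: CoppersmithWinograd1990, §8] -/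
theorem hasFormatValue_cwSqComp130 : HasFormatValue (cwSqComp K q 1 3 0) 1 (2 * q) 1 1 := by
  rw [cwSqComp_rotate K q 0 1 3]; exact (hasFormatValue_cwSqComp013 K q).rotate_modes

/-- `T^{[301]} = T^{[130]}_C ≥ ⟨1,1,2q⟩`: format `(1,1,2q)`. [cite: CoppersmithWinograd1990, §8] -/
theorem hasFormatValue_cwSqComp301 : HasFormatValue (cwSqComp K q 3 0 1) 1 1 1 (2 * q) := by
  rw [cwSqComp_rotate K q 1 3 0]; exact (hasFormatValue_cwSqComp130 K q).rotate_modes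

/-- **`T^{[031]} ≥ ⟨1,2q,1⟩`**: format `(1,2q,1)`. [cite: CoppersmithWinograd1990, §8]
[cite: LeGall2012, §3] -/
theorem hasFormatValue_cwSqComp031 : HasFormatValue (cwSqComp K q 0 3 1) 1 1 (2 * q) 1 := by
  have h := (hasFormatValue_matMulTensor K 1 (q + q) 1).of_restrictsTo
    (tensorRestrictsTo_cwSqComp031 K q)
  simp only [Nat.cast_one, Nat.cast_add] at h
  rw [← two_mul] at h
  exact h

/-- `T^{[310]} = T^{[031]}_C ≥ ⟨2q,1,1⟩`: format `(2q,1,1)`. [cite: CoppersmithWinograd1990, §8] -/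
theorem hasFormatValue_cwSqComp310 : HasFormatValue (cwSqComp K q 3 1 0) 1 (2 * q) 1 1 := by
  rw [cwSqComp_rotate K q 0 3 1]; exact (hasFormatValue_cwSqComp031 K q).rotate_modes

/-- `T^{[103]} = T^{[310]}_C ≥ ⟨1,1,2q⟩`: format `(1,1,2q)`. [cite: CoppersmithWinograd1990, §8] -/
theorem hasFormatValue_cwSqComp103 : HasFormatValue (cwSqComp K q 1 0 3) 1 1 1 (2 * q) := by
  rw [cwSqComp_rotate K q 3 1 0]; exact (hasFormatValue_cwSqComp310 K q).rotate_modes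

/-- **`T^{[022]} ≥ ⟨1,q²+2,1⟩`**: format `(1,q²+2,1)` (`x_{00}·(y_{0,q+1}z_{q+1,0} + y_{q+1,0}z_{0,q+1}
+ ∑_{ij} y_{ij} z_{ij})`, an inner product of length `q²+2`). [cite: CoppersmithWinograd1990, §8]
[cite: LeGall2012, §3] -/
theorem hasFormatValue_cwSqComp022 : HasFormatValue (cwSqComp K q 0 2 2) 1 1 (q * q + 2) 1 := by
  have h := (hasFormatValue_matMulTensor K 1 (q * q + 2) 1).of_restrictsTo
    (tensorRestrictsTo_cwSqComp022 K q)
  simp only [Nat.cast_one, Nat.cast_add, Nat.cast_mul, Nat.cast_ofNat] at h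
  exact h

/-- `T^{[220]} = T^{[022]}_C ≥ ⟨q²+2,1,1⟩`: format `(q²+2,1,1)`. [cite: CoppersmithWinograd1990, §8] -/
theorem hasFormatValue_cwSqComp220 : HasFormatValue (cwSqComp K q 2 2 0) 1 (q * q + 2) 1 1 := by
  rw [cwSqComp_rotate K q 0 2 2]; exact (hasFormatValue_cwSqComp022 K q).rotate_modes

/-- `T^{[202]} = T^{[220]}_C ≥ ⟨1,1,q²+2⟩`: format `(1,1,q²+2)`. [cite: CoppersmithWinograd1990, §8] -/
theorem hasFormatValue_cwSqComp202 : HasFormatValue (cwSqComp K q 2 0 2) 1 1 1 (q * q + 2) := by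
  rw [cwSqComp_rotate K q 2 2 0]; exact (hasFormatValue_cwSqComp220 K q).rotate_modes

end Matrix

/-! ## The twelve as one statement: matrix patterns and their format tables -/

section Table

variable (q : ℕ)

/-- The twelve MATRIX patterns `(I,J,L)`, `I+J+L = 4`, of `CW_q^{⊗2}` (all patterns except
`(1,1,2), (1,2,1), (2,1,1)`). [cite: LeGall2012, §3] -/
def cwSqMatrix₂ : Finset (Fin 5 × Fin 5 × Fin 5) :=
  {(0, 0, 4), (0, 4, 0), (4, 0, 0), (0, 1, 3), (0, 3, 1), (1, 0, 3), (1, 3, 0), (3, 0, 1), (3, 1, 0),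
    (0, 2, 2), (2, 0, 2), (2, 2, 0)}

/-- The length of the inner product paired at level `J ∈ {0,…,4}`: the number of level-`J` variables
of `CW_q^{⊗2}`, `(1, 2q, q²+2, 2q, 1)`. [cite: LeGall2012, §3] -/
def cwSqDim (J : Fin 5) : ℝ :=
  if J = 0 then 1 else if J = 1 then 2 * q else if J = 2 then q * q + 2 else if J = 3 then 2 * q else 1

/-- First format of the matrix pattern `s`: `cwSqDim I` if `L = 0` (an `x–y` pairing), else `1`.
[cite: LeGall2012, §3] -/
def cwSqFmtA (s : Fin 5 × Fin 5 × Fin 5) : ℝ := if s.2.2 = 0 ∧ s.1 ≠ 0 then cwSqDim q s.1 else 1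

/-- Second format: `cwSqDim J` if `I = 0` (a `y–z` pairing), else `1`. [cite: LeGall2012, §3] -/
def cwSqFmtB (s : Fin 5 × Fin 5 × Fin 5) : ℝ := if s.1 = 0 ∧ s.2.1 ≠ 0 then cwSqDim q s.2.1 else 1

/-- Third format: `cwSqDim I` if `J = 0` (an `x–z` pairing), else `1`. [cite: LeGall2012, §3] -/
def cwSqFmtC (s : Fin 5 × Fin 5 × Fin 5) : ℝ := if s.2.1 = 0 ∧ s.1 ≠ 0 then cwSqDim q s.1 else 1

/-- `cwSqDim J ≥ 1` (`q ≥ 1`). [cite: LeGall2012, §3] -/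
theorem one_le_cwSqDim (hq : 1 ≤ q) (J : Fin 5) : 1 ≤ cwSqDim q J := by
  unfold cwSqDim
  have hq' : (1 : ℝ) ≤ q := by exact_mod_cast hq
  split_ifs <;> nlinarith

/-- The first format of a matrix pattern is `≥ 1` (`q ≥ 1`). [cite: LeGall2012, §3] -/
theorem one_le_cwSqFmtA (hq : 1 ≤ q) (s : Fin 5 × Fin 5 × Fin 5) : 1 ≤ cwSqFmtA q s := by
  unfold cwSqFmtA; split_ifs
  · exact one_le_cwSqDim q hq _
  · exact le_rfl

/-- The second format of a matrix pattern is `≥ 1` (`q ≥ 1`). [cite: LeGall2012, §3] -/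
theorem one_le_cwSqFmtB (hq : 1 ≤ q) (s : Fin 5 × Fin 5 × Fin 5) : 1 ≤ cwSqFmtB q s := by
  unfold cwSqFmtB; split_ifs
  · exact one_le_cwSqDim q hq _
  · exact le_rfl

/-- The third format of a matrix pattern is `≥ 1` (`q ≥ 1`). [cite: LeGall2012, §3] -/
theorem one_le_cwSqFmtC (hq : 1 ≤ q) (s : Fin 5 × Fin 5 × Fin 5) : 1 ≤ cwSqFmtC q s := by
  unfold cwSqFmtC; split_ifs
  · exact one_le_cwSqDim q hq _
  · exact le_rfl

/-- The first format of a matrix pattern is positive (`q ≥ 1`; the positivity hypothesis of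
`laserMethod_hasFormatValue_of_counts`). [cite: LeGall2012, §3] [cite: LeGall2014, Thm. 4.1] -/
theorem cwSqFmtA_pos (hq : 1 ≤ q) (s : Fin 5 × Fin 5 × Fin 5) : 0 < cwSqFmtA q s :=
  lt_of_lt_of_le one_pos (one_le_cwSqFmtA q hq s)

/-- The second format of a matrix pattern is positive (`q ≥ 1`; the positivity hypothesis of
`laserMethod_hasFormatValue_of_counts`). [cite: LeGall2012, §3] [cite: LeGall2014, Thm. 4.1] -/
theorem cwSqFmtB_pos (hq : 1 ≤ q) (s : Fin 5 × Fin 5 × Fin 5) : 0 < cwSqFmtB q s :=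
  lt_of_lt_of_le one_pos (one_le_cwSqFmtB q hq s)

/-- The third format of a matrix pattern is positive (`q ≥ 1`; the positivity hypothesis of
`laserMethod_hasFormatValue_of_counts`). [cite: LeGall2012, §3] [cite: LeGall2014, Thm. 4.1] -/
theorem cwSqFmtC_pos (hq : 1 ≤ q) (s : Fin 5 × Fin 5 × Fin 5) : 0 < cwSqFmtC q s :=
  lt_of_lt_of_le one_pos (one_le_cwSqFmtC q hq s)

variable (K : Type u) [Field K]

/-- **The twelve matrix components of `CW_q^{⊗2}` in format currency, as one statement**: for every
matrix pattern `s = (I,J,L)`, `T^{[IJL]}` is worth one product of format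
`(cwSqFmtA s, cwSqFmtB s, cwSqFmtC s)` — the table `[004],[040],[400] ↦ (1,1,1)`, `[013],[031] ↦
(1,2q,1)`, `[130],[310] ↦ (2q,1,1)`, `[301],[103] ↦ (1,1,2q)`, `[022] ↦ (1,q²+2,1)`, `[220] ↦
(q²+2,1,1)`, `[202] ↦ (1,1,q²+2)`. [cite: CoppersmithWinograd1990, §8] [cite: LeGall2012, §3] -/
theorem hasFormatValue_cwSqComp_matrix (s : Fin 5 × Fin 5 × Fin 5) (hs : s ∈ cwSqMatrix₂) :
    HasFormatValue (cwSqComp K q s.1 s.2.1 s.2.2) 1 (cwSqFmtA q s) (cwSqFmtB q s) (cwSqFmtC q s) := by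
  simp only [cwSqMatrix₂, Finset.mem_insert, Finset.mem_singleton] at hs
  rcases hs with rfl | rfl | rfl | rfl | rfl | rfl | rfl | rfl | rfl | rfl | rfl | rfl
  · simpa [cwSqFmtA, cwSqFmtB, cwSqFmtC, cwSqDim] using hasFormatValue_cwSqComp004 K q
  · simpa [cwSqFmtA, cwSqFmtB, cwSqFmtC, cwSqDim] using hasFormatValue_cwSqComp040 K q
  · simpa [cwSqFmtA, cwSqFmtB, cwSqFmtC, cwSqDim] using hasFormatValue_cwSqComp400 K q
  · simpa [cwSqFmtA, cwSqFmtB, cwSqFmtC, cwSqDim] using hasFormatValue_cwSqComp013 K q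
  · simpa [cwSqFmtA, cwSqFmtB, cwSqFmtC, cwSqDim] using hasFormatValue_cwSqComp031 K q
  · simpa [cwSqFmtA, cwSqFmtB, cwSqFmtC, cwSqDim] using hasFormatValue_cwSqComp103 K q
  · simpa [cwSqFmtA, cwSqFmtB, cwSqFmtC, cwSqDim] using hasFormatValue_cwSqComp130 K q
  · simpa [cwSqFmtA, cwSqFmtB, cwSqFmtC, cwSqDim] using hasFormatValue_cwSqComp301 K q
  · simpa [cwSqFmtA, cwSqFmtB, cwSqFmtC, cwSqDim] using hasFormatValue_cwSqComp310 K q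
  · simpa [cwSqFmtA, cwSqFmtB, cwSqFmtC, cwSqDim] using hasFormatValue_cwSqComp022 K q
  · simpa [cwSqFmtA, cwSqFmtB, cwSqFmtC, cwSqDim] using hasFormatValue_cwSqComp202 K q
  · simpa [cwSqFmtA, cwSqFmtB, cwSqFmtC, cwSqDim] using hasFormatValue_cwSqComp220 K q

/-- The product of the first and third formats of a matrix pattern with `x`-level `I ≠ 0` is the
number `cwSqDim I` of level-`I` `x`-variables, and is `1` when `I = 0` — the identity behind the
`x`-tightness `M·Q² = (q+2)²` of the `α`-designs (every `x`-variable used at its natural frequency).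
[cite: LeGall2012, §6.2 and §7.3] -/
theorem cwSqFmtA_mul_cwSqFmtC (s : Fin 5 × Fin 5 × Fin 5) (hs : s ∈ cwSqMatrix₂) :
    cwSqFmtA q s * cwSqFmtC q s = if s.1 = 0 then 1 else cwSqDim q s.1 := by
  simp only [cwSqMatrix₂, Finset.mem_insert, Finset.mem_singleton] at hs
  rcases hs with rfl | rfl | rfl | rfl | rfl | rfl | rfl | rfl | rfl | rfl | rfl | rfl <;>
    simp [cwSqFmtA, cwSqFmtC, cwSqDim]

end Table

end Literature.Computability.AlgebraicComplexity
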